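import Literature.Analysis.FluidPDE.LocalEnergySolutionsOn
import Literature.Analysis.FluidPDE.KatoCaloricField
import Literature.Analysis.FluidPDE.MildSolutionHeatFlowProofs
import HarnessLib

/-!
# Slice tools for the caloric layer of a local energy solution with `L²` datum

Analysis/FluidPDE proof file (theorems only, no definitions, no named facts) on the way to the
discharge of `Literature.Analysis.FluidPDE.BarkerPrange2020_thm2` (Barker–Prange 2020, Thm. 2) by
compactness. For a local energy solution `(v, π)` on `(0,T) × ℝ³` with datum `v₀ ∈ L²(ℝ³)`
(Kikuchi–Seregin / Kang–Miura–Tsai class `IsLocalEnergySolutionOn`) and the layer functional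
`Y(t) = ∫ θ_{x₀} |v(t) - e^{tΔ}v₀|²`, `θ_{x₀} = (cutoff 1 (· - x₀))²`:

* `IsLocalEnergySolutionOn.lintegral_ball_datum_le` — unit-ball bounds `∫_{B(x₀,1)}|v(t)|² ≤ A`
  for `0 < t < T` pass to the datum (strong `L²_loc` attainment of the datum, (B.1.7));
* `IsLocalEnergySolutionOn.tendsto_layer_nhdsWithin_zero` — `Y(t) → 0` as `t → 0⁺` ((B.1.7) and
  the `L²` continuity of the heat semigroup at `t = 0`).

## References

* T. Barker, C. Prange, Arch. Ration. Mech. Anal. 236 (2020) 1487–1541 = arXiv:1812.09115, Thm. 2,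
  §4.2 (p. 16). [BarkerPrange2020]
* G. Seregin, *Lecture notes on regularity theory for the Navier–Stokes equations* (2014),
  Def. B.1 (B.1.7). [Seregin2014]
-/

noncomputable section

open MeasureTheory Set Function Filter Metric
open _root_.Topology
open scoped ENNReal NNReal

namespace Literature.Analysis.FluidPDE

namespace BarkerPrange2020

/-! ## `L²` tools -/

section Tools

/-- `∫⁻ ‖f‖ₑ² ≤ (eLpNorm f 2 μ)²` (in fact an equality). [folklore] -/
theorem lintegral_enorm_sq_le_eLpNorm_sq {α F : Type*} [MeasurableSpace α] {μ : Measure α}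
    [NormedAddCommGroup F] (f : α → F) : ∫⁻ x, ‖f x‖ₑ ^ 2 ∂μ ≤ eLpNorm f 2 μ ^ 2 := by
  have h1 : eLpNorm f 2 μ = (∫⁻ x, ‖f x‖ₑ ^ 2 ∂μ) ^ (1 / 2 : ℝ) := by
    rw [eLpNorm_eq_lintegral_rpow_enorm_toReal (by norm_num) (by norm_num)]
    simp only [ENNReal.toReal_ofNat, ENNReal.rpow_ofNat]
  rw [h1, ← ENNReal.rpow_natCast _ 2, ← ENNReal.rpow_mul]
  norm_num

/-- `(eLpNorm f 2 μ)² ≤ ∫⁻ ‖f‖ₑ²` (in fact an equality). [folklore] -/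
theorem eLpNorm_sq_le_lintegral_enorm_sq {α F : Type*} [MeasurableSpace α] {μ : Measure α}
    [NormedAddCommGroup F] (f : α → F) : eLpNorm f 2 μ ^ 2 ≤ ∫⁻ x, ‖f x‖ₑ ^ 2 ∂μ := by
  have h1 : eLpNorm f 2 μ = (∫⁻ x, ‖f x‖ₑ ^ 2 ∂μ) ^ (1 / 2 : ℝ) := by
    rw [eLpNorm_eq_lintegral_rpow_enorm_toReal (by norm_num) (by norm_num)]
    simp only [ENNReal.toReal_ofNat, ENNReal.rpow_ofNat]
  rw [h1, ← ENNReal.rpow_natCast _ 2, ← ENNReal.rpow_mul]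
  norm_num

/-- Private copy of the two-term quadratic inequality for extended norms. [folklore] -/
theorem enorm_sub_sq_le_two_mul_add {F : Type*} [NormedAddCommGroup F] (a b c : F) :
    ‖a - b‖ₑ ^ 2 ≤ 2 * ‖a - c‖ₑ ^ 2 + 2 * ‖b - c‖ₑ ^ 2 := by
  have h : ‖a - b‖ ^ 2 ≤ 2 * ‖a - c‖ ^ 2 + 2 * ‖b - c‖ ^ 2 := by
    have h1 : ‖a - b‖ ≤ ‖a - c‖ + ‖b - c‖ := by
      have := norm_sub_le (a - c) (b - c); rwa [sub_sub_sub_cancel_right] at this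
    nlinarith [sq_nonneg (‖a - c‖ - ‖b - c‖), norm_nonneg (a - b), norm_nonneg (a - c), norm_nonneg (b - c)]
  calc ‖a - b‖ₑ ^ 2 = ENNReal.ofReal (‖a - b‖ ^ 2) := by rw [← ofReal_norm, ENNReal.ofReal_pow (norm_nonneg _)]
    _ ≤ ENNReal.ofReal (2 * ‖a - c‖ ^ 2 + 2 * ‖b - c‖ ^ 2) := ENNReal.ofReal_le_ofReal h
    _ = 2 * ‖a - c‖ₑ ^ 2 + 2 * ‖b - c‖ₑ ^ 2 := by
        rw [ENNReal.ofReal_add (by positivity) (by positivity), ENNReal.ofReal_mul zero_le_two,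
          ENNReal.ofReal_mul zero_le_two, ENNReal.ofReal_pow (norm_nonneg _), ENNReal.ofReal_pow (norm_nonneg _),
          ofReal_norm, ofReal_norm, ENNReal.ofReal_ofNat]

end Tools

/-! ## The datum and the layer of a local energy solution -/

section Slices

variable {T : ℝ} {v₀ : EuclideanSpace ℝ (Fin 3) → EuclideanSpace ℝ (Fin 3)}
  {v : ℝ → EuclideanSpace ℝ (Fin 3) → EuclideanSpace ℝ (Fin 3)}
  {π : ℝ → EuclideanSpace ℝ (Fin 3) → ℝ}

/-- **Unit-ball energy bounds pass to the datum.** If `∫_{B(x₀,1)} |v(t)|² ≤ A` for all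
`0 < t < T` then `∫_{B(x₀,1)} |v₀|² ≤ A`: by (B.1.7), `‖v(t) - v₀‖_{L²(B)} → 0`, and
`‖v₀‖_{L²(B)} ≤ ‖v(t)‖_{L²(B)} + ‖v(t) - v₀‖_{L²(B)}`. [cite: Seregin2014, Def. B.1 (B.1.7)] -/
theorem _root_.Literature.Analysis.FluidPDE.IsLocalEnergySolutionOn.lintegral_ball_datum_le
    (h : IsLocalEnergySolutionOn T 1 v₀ v π) (hT : 0 < T) (hv₀ : AEStronglyMeasurable v₀ volume)
    {A : ℝ≥0∞} (x₀ : EuclideanSpace ℝ (Fin 3))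
    (hA : ∀ t ∈ Ioo 0 T, ∫⁻ x in ball x₀ 1, ‖v t x‖ₑ ^ 2 ≤ A) :
    ∫⁻ x in ball x₀ 1, ‖v₀ x‖ₑ ^ 2 ≤ A := by
  set μB : Measure (EuclideanSpace ℝ (Fin 3)) := volume.restrict (ball x₀ 1) with hμB
  -- `‖v(t) - v₀‖_{L²(B)} → 0`
  have h0 : Tendsto (fun t => ∫⁻ x in ball x₀ 1, ‖v t x - v₀ x‖ₑ ^ 2) (𝓝[>] 0) (𝓝 0) :=
    tendsto_of_tendsto_of_tendsto_of_le_of_le tendsto_const_nhds (h.initial _ (isCompact_closedBall x₀ 1))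
      (fun _ => bot_le) (fun _ => lintegral_mono_set ball_subset_closedBall)
  have h1 : Tendsto (fun t => eLpNorm (v t - v₀) 2 μB) (𝓝[>] 0) (𝓝 0) := by
    have hc : Tendsto (fun r : ℝ≥0∞ => r ^ (1 / 2 : ℝ)) (𝓝 0) (𝓝 0) := by
      have := (ENNReal.continuous_rpow_const (y := (1 / 2 : ℝ))).tendsto 0
      rwa [ENNReal.zero_rpow_of_pos (by norm_num)] at this
    refine tendsto_of_tendsto_of_tendsto_of_le_of_le tendsto_const_nhds (hc.comp h0) (fun _ => bot_le)
      (fun t => ?_)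
    exact eLpNorm_two_le_rpow_of_lintegral_sq_le le_rfl
  -- the triangle inequality at times `0 < t < T`
  have h2 : ∀ᶠ t in 𝓝[>] (0 : ℝ), eLpNorm v₀ 2 μB ≤ A ^ (1 / 2 : ℝ) + eLpNorm (v t - v₀) 2 μB := by
    have hT' : Ioo 0 T ∈ 𝓝[>] (0 : ℝ) := Ioo_mem_nhdsGT hT
    filter_upwards [hT'] with t ht
    have hvm : AEStronglyMeasurable (v t) μB := (h.sliceMeasurable t ⟨ht.1.le, ht.2.le⟩).restrict
    have hdm : AEStronglyMeasurable (v t - v₀) μB := hvm.sub hv₀.restrict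
    have heq : v₀ = v t - (v t - v₀) := by simp
    calc eLpNorm v₀ 2 μB = eLpNorm (v t - (v t - v₀)) 2 μB := by rw [← heq]
      _ ≤ eLpNorm (v t) 2 μB + eLpNorm (v t - v₀) 2 μB := eLpNorm_sub_le hvm hdm (by norm_num)
      _ ≤ A ^ (1 / 2 : ℝ) + eLpNorm (v t - v₀) 2 μB := add_le_add (eLpNorm_two_le_rpow_of_lintegral_sq_le (hA t ht)) le_rfl
  have h3 : eLpNorm v₀ 2 μB ≤ A ^ (1 / 2 : ℝ) := by
    have hlim : Tendsto (fun t => A ^ (1 / 2 : ℝ) + eLpNorm (v t - v₀) 2 μB) (𝓝[>] 0) (𝓝 (A ^ (1 / 2 : ℝ))) := by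
      have := h1.const_add (A ^ (1 / 2 : ℝ))
      rwa [add_zero] at this
    exact ge_of_tendsto hlim h2
  calc ∫⁻ x in ball x₀ 1, ‖v₀ x‖ₑ ^ 2 ≤ eLpNorm v₀ 2 μB ^ 2 := lintegral_enorm_sq_le_eLpNorm_sq _
    _ ≤ (A ^ (1 / 2 : ℝ)) ^ 2 := pow_le_pow_left' h3 2
    _ = A := by rw [← ENNReal.rpow_natCast _ 2, ← ENNReal.rpow_mul]; norm_num

/-- **The layer functional vanishes at `t = 0⁺`.** For a local energy solution with datum
`v₀ ∈ L²(ℝ³)` and every centre `x₀`,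
`Y(t) = ∫ (cutoff 1 (x - x₀))² |v(t,x) - e^{tΔ}v₀(x)|² dx → 0` as `t → 0⁺`: the weight is `≤ 1`
and supported in `B̄(x₀, 2)`, `∫_{B̄(x₀,2)} |v(t) - v₀|² → 0` by (B.1.7) and
`‖e^{tΔ}v₀ - v₀‖₂ → 0`. [cite: Seregin2014, Def. B.1 (B.1.7); BarkerPrange2020, §4.2] -/
theorem _root_.Literature.Analysis.FluidPDE.IsLocalEnergySolutionOn.tendsto_layer_nhdsWithin_zero
    (h : IsLocalEnergySolutionOn T 1 v₀ v π) (hv₀ : MemLp v₀ 2 volume) (x₀ : EuclideanSpace ℝ (Fin 3)) :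
    Tendsto (fun t => ∫ x, cutoff (1 : ℝ) (x - x₀) ^ 2 * ‖v t x - heatFlow v₀ (1 * t) x‖ ^ 2)
      (𝓝[>] 0) (𝓝 0) := by
  set K : Set (EuclideanSpace ℝ (Fin 3)) := closedBall x₀ 2 with hK
  have hKc : IsCompact K := isCompact_closedBall x₀ 2
  -- the two `L²_loc` convergences
  have hv : Tendsto (fun t => ∫⁻ x in K, ‖v t x - v₀ x‖ₑ ^ 2) (𝓝[>] 0) (𝓝 0) := h.initial K hKc
  have he : Tendsto (fun t => ∫⁻ x in K, ‖heatFlow v₀ (1 * t) x - v₀ x‖ₑ ^ 2) (𝓝[>] 0) (𝓝 0) := by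
    have h1 : Tendsto (fun t : ℝ => eLpNorm (heatFlow v₀ t - v₀) 2 volume) (𝓝[>] 0) (𝓝 0) :=
      (tendsto_heatFlow_nhdsWithin_zero_holds hv₀ (by norm_num) (by norm_num)).mono_left
        (nhdsWithin_mono _ Ioi_subset_Ici_self)
    have h2 : Tendsto (fun t : ℝ => eLpNorm (heatFlow v₀ t - v₀) 2 volume ^ 2) (𝓝[>] 0) (𝓝 0) := by
      have := ((ENNReal.continuous_pow 2).tendsto 0).comp h1
      rwa [zero_pow two_ne_zero] at this
    refine tendsto_of_tendsto_of_tendsto_of_le_of_le tendsto_const_nhds h2 (fun _ => bot_le) (fun t => ?_)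
    rw [one_mul]
    exact (lintegral_mono' Measure.restrict_le_self le_rfl).trans (lintegral_enorm_sq_le_eLpNorm_sq _)
  set Z : ℝ → ℝ≥0∞ := fun t => (2 * ∫⁻ x in K, ‖v t x - v₀ x‖ₑ ^ 2) +
    2 * ∫⁻ x in K, ‖heatFlow v₀ (1 * t) x - v₀ x‖ₑ ^ 2 with hZ
  have hZ0 : Tendsto Z (𝓝[>] 0) (𝓝 0) := by
    have h2 : (2 : ℝ≥0∞) ≠ ∞ := by simp
    have := (ENNReal.Tendsto.const_mul hv (Or.inr h2)).add (ENNReal.Tendsto.const_mul he (Or.inr h2))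
    simpa [hZ] using this
  have hZr : Tendsto (fun t => (Z t).toReal) (𝓝[>] 0) (𝓝 0) := by
    have := (ENNReal.tendsto_toReal ENNReal.zero_ne_top).comp hZ0
    rw [ENNReal.toReal_zero] at this
    exact this
  -- the pointwise bound `θ |w|² ≤ 1_K (2|v - v₀|² + 2|e - v₀|²)`
  have hθ0 : ∀ x, 0 ≤ cutoff (1 : ℝ) (x - x₀) ^ 2 := fun x => sq_nonneg _
  have hθ1 : ∀ x, cutoff (1 : ℝ) (x - x₀) ^ 2 ≤ 1 := fun x => by
    have h0 := cutoff_nonneg (E := EuclideanSpace ℝ (Fin 3)) 1 (x - x₀)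
    have h1 := cutoff_le_one (E := EuclideanSpace ℝ (Fin 3)) 1 (x - x₀)
    nlinarith
  have hθK : ∀ x, x ∉ K → cutoff (1 : ℝ) (x - x₀) ^ 2 = 0 := fun x hx => by
    have hx' : 2 * (1 : ℝ) ≤ ‖x - x₀‖ := by
      rw [hK, mem_closedBall, dist_eq_norm] at hx
      linarith
    rw [cutoff_eq_zero one_pos hx', zero_pow two_ne_zero]
  -- the bound `Y(t) ≤ (Z t).toReal`, eventually (when `Z t < ∞`)
  have hY0 : ∀ t, 0 ≤ ∫ x, cutoff (1 : ℝ) (x - x₀) ^ 2 * ‖v t x - heatFlow v₀ (1 * t) x‖ ^ 2 :=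
    fun t => integral_nonneg fun x => mul_nonneg (hθ0 x) (sq_nonneg _)
  have hfin : ∀ᶠ t in 𝓝[>] (0 : ℝ), Z t < ∞ := hZ0.eventually (gt_mem_nhds ENNReal.zero_lt_top)
  have hle : ∀ᶠ t in 𝓝[>] (0 : ℝ),
      ∫ x, cutoff (1 : ℝ) (x - x₀) ^ 2 * ‖v t x - heatFlow v₀ (1 * t) x‖ ^ 2 ≤ (Z t).toReal := by
    filter_upwards [hfin, self_mem_nhdsWithin] with t ht ht0
    have hgm : AEMeasurable (fun x => 2 * ‖heatFlow v₀ (1 * t) x - v₀ x‖ₑ ^ 2) (volume.restrict K) := by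
      have hc : Continuous (heatFlow v₀ (1 * t)) := by
        rw [heatFlow_of_pos v₀ (by simpa using ht0)]
        exact (UnboundedOperators.contDiff_heatExtension_holds hv₀ (by norm_num) (by simpa using ht0)).continuous
      exact ((hc.aestronglyMeasurable.sub hv₀.1).aemeasurable.enorm.pow_const _).restrict.const_mul _
    set f : EuclideanSpace ℝ (Fin 3) → ℝ := fun x => cutoff (1 : ℝ) (x - x₀) ^ 2 * ‖v t x - heatFlow v₀ (1 * t) x‖ ^ 2
      with hf
    by_cases hfm : AEStronglyMeasurable f volume
    swap
    · rw [integral_non_aestronglyMeasurable hfm]; exact ENNReal.toReal_nonneg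
    rw [integral_eq_lintegral_of_nonneg_ae (Eventually.of_forall fun x => mul_nonneg (hθ0 x) (sq_nonneg _)) hfm]
    refine ENNReal.toReal_mono ht.ne ?_
    -- `∫⁻ ofReal f ≤ Z t`
    have hpt : ∀ x, ENNReal.ofReal (f x) ≤
        K.indicator (fun x => 2 * ‖v t x - v₀ x‖ₑ ^ 2 + 2 * ‖heatFlow v₀ (1 * t) x - v₀ x‖ₑ ^ 2) x := by
      intro x
      by_cases hx : x ∈ K
      · rw [indicator_of_mem hx, hf]
        dsimp only
        calc ENNReal.ofReal (cutoff (1 : ℝ) (x - x₀) ^ 2 * ‖v t x - heatFlow v₀ (1 * t) x‖ ^ 2)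
            ≤ ENNReal.ofReal (‖v t x - heatFlow v₀ (1 * t) x‖ ^ 2) :=
              ENNReal.ofReal_le_ofReal (mul_le_of_le_one_left (sq_nonneg _) (hθ1 x))
          _ = ‖v t x - heatFlow v₀ (1 * t) x‖ₑ ^ 2 := by rw [← ofReal_norm, ENNReal.ofReal_pow (norm_nonneg _)]
          _ ≤ _ := enorm_sub_sq_le_two_mul_add _ _ _
      · rw [indicator_of_notMem hx, hf]
        dsimp only
        rw [hθK x hx, zero_mul, ENNReal.ofReal_zero]
    calc ∫⁻ x, ENNReal.ofReal (f x) ≤ ∫⁻ x, K.indicator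
          (fun x => 2 * ‖v t x - v₀ x‖ₑ ^ 2 + 2 * ‖heatFlow v₀ (1 * t) x - v₀ x‖ₑ ^ 2) x := lintegral_mono hpt
      _ = ∫⁻ x in K, (2 * ‖v t x - v₀ x‖ₑ ^ 2 + 2 * ‖heatFlow v₀ (1 * t) x - v₀ x‖ₑ ^ 2) :=
          lintegral_indicator measurableSet_closedBall _
      _ = (∫⁻ x in K, 2 * ‖v t x - v₀ x‖ₑ ^ 2) + ∫⁻ x in K, 2 * ‖heatFlow v₀ (1 * t) x - v₀ x‖ₑ ^ 2 :=
          lintegral_add_right' _ hgm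
      _ = Z t := by
          simp only [hZ]
          rw [lintegral_const_mul' _ _ (by simp), lintegral_const_mul' _ _ (by simp)]
  exact tendsto_of_tendsto_of_tendsto_of_le_of_le' tendsto_const_nhds hZr (Eventually.of_forall hY0) hle

end Slices

end BarkerPrange2020

end Literature.Analysis.FluidPDE

end
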